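import Literature.MathematicalPhysics.QuantumFieldTheory.Balaban1983to89.BlockAveragingTwoLevelEMLHaarAC

/-!
# Block averaging with the PRINTED exp-mean-log average on `SU(N)`: `HaarAC` from ONE named fibre law

`BlockAveragingEMLHaarAC` (one-level averaging (0.4) of [Balaban1987RG1] p. 253) and `BlockAveragingTwoLevelEMLHaarAC`
(two-level averaging (0.11)–(0.12) pp. 253–254, every inner group average `M`) reduced the measure-theoretic residual `HaarAC`
of `T4FiniteEpsInhabited` for the PRINTED small-loop average `ExpMeanLog.expMeanLogSU` on `SU(N)` — for EVERY `N` — to the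
absolute continuity of ONE family of guarded one-variable laws (`haarAC_avgFun_of_guard`, `haarAC_avgFun₂_of_guard`), and put
those laws, on `SU(N)`, in the normal form `W ↦ exp(Σ_k c_k log(h_k W*)) · W` on an open guard, with weights `c_k ≥ 0` of total
`< 1` and `‖h_k W* − 1‖ < 1/3` there (`coe_fibreCore_eq`, `coe_fibreCore₂_eq`); they discharged the laws on `SU(2)` by the
quaternionic fibre lemma `T4EMLFibreAC.haarData_restrict_map_absolutelyContinuous_expMeanLog`.  This module ISOLATES THE
CONTRACT for general `N`: it names the statement SHAPE of that fibre lemma with `Fin 2` replaced by an arbitrary index type `n`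
— `EMLFibreLaw n` (§1) — proves that the shape is INHABITED at `n = Fin 2` by the tree's theorem (`emlFibreLaw_fin_two`), and
proves, for every `n`, that `EMLFibreLaw n` ALONE gives `HaarAC` for both printed averagings on `SU(n)` together with the
inhabitation corollaries (§2 one-level, §3 two-level), recovering the landed `SU(2)` theorems as instances (§4, `example`s only).
So the census item «`BlockHaarAC` / `BlockHaarAC₂` with the printed outer average, `N ≥ 3`» of `T4ApexTwoLevel` §6 is, in the
kernel, EXACTLY the one analytic statement `EMLFibreLaw (Fin N)`; producing it for `N ≥ 3` (a map-independent Haar-AC engine on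
`SU(N)` plus the injectivity of the differential of `W ↦ exp(Σ_k c_k log(h_k W*)) · W`, cf. the division of labour recorded in
the cell journal 2026-08-19) is NOT done here.

## What this is NOT

No fibre law is proved here beyond `N = 2` (which is the tree's).  The inhabitation corollaries produce the STUB inhabitant of
`T4FiniteEpsInhabited` §3 (placeholder `Realisation`), at which the pinned end statement (B) of the cell FAILS
(`not_endStatementBPrinted_blockAvgEML_stub_of_fibreLaw`): carrier inhabitation, not the theorem.  Nothing here is progress on
the continuum limit (Theorems 1–2 of [Balaban1987RG1]) or on the summit: the node is OFF the spine of the cell's T4 DAG, and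
every result is elementary measure theory ([folklore]) about the published formulas (0.4), (0.11)–(0.12) pp. 253–254, whose
citations are carried by `BlockAveraging` / `BlockAveragingTwoLevel` (nothing printed is asserted here; no new citation).  The
inner average `M` of (0.11) stays axiomatic (`BlockAveragingTwoLevel.GroupAverage`).

## Versions

* v1: the module.
-/

noncomputable section

open MeasureTheory Function NormedSpace

namespace Literature.MathematicalPhysics.QuantumFieldTheory.Balaban1983to89

namespace BlockAveragingEMLHaarACSUN

open T4Continuum AveragingRT BlockAveraging BlockAveragingHaarAC BlockAveragingTwoLevel BlockAveragingTwoLevelHaarAC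
open BlockAveragingEMLHaarAC BlockAveragingTwoLevelEMLHaarAC
open ExpMeanLog MatrixLog
open scoped Matrix.Norms.L2Operator

/-! ## 1. The contract: the exp-mean-log fibre law on `SU(n)` -/

/-- **THE EXP-MEAN-LOG FIBRE LAW ON `SU(n)`** (a statement SHAPE, not a theorem for general `n`): for every finite index type
`ι`, every OPEN `S ⊆ SU(n)`, every family `h : ι → SU(n)`, all weights `c_i ≥ 0` of total `< 1`, and every measurable
`K : SU(n) → SU(n)` with `‖h_i W* − 1‖ < 1/2` on `S` and `K W = exp(Σ_i c_i log(h_i W*)) · W` on `S` (series logarithm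
`MatrixLog.mlog`), the law `((Haar).restrict S).map K` is absolutely continuous with respect to Haar measure.  Verbatim the
statement of `T4EMLFibreAC.haarData_restrict_map_absolutelyContinuous_expMeanLog` with `Fin 2` replaced by `n` (the index
type taken in `Type`, the weights explicit). [folklore] -/
def EMLFibreLaw (n : Type) [DecidableEq n] [Fintype n] [Nonempty n] : Prop :=
  ∀ {ι : Type} [Fintype ι] {S : Set (Matrix.specialUnitaryGroup n ℂ)}, IsOpen S →
    ∀ (h : ι → Matrix.specialUnitaryGroup n ℂ) (c : ι → ℝ), (∀ i, 0 ≤ c i) → ∑ i, c i < 1 →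
    ∀ {K : Matrix.specialUnitaryGroup n ℂ → Matrix.specialUnitaryGroup n ℂ}, Measurable K →
      (∀ W ∈ S, ∀ i, ‖(h i : Matrix n n ℂ) * star (W : Matrix n n ℂ) - 1‖ < 1 / 2) →
      (∀ W ∈ S, (K W : Matrix n n ℂ) =
        NormedSpace.exp (∑ i, (c i : ℂ) • MatrixLog.mlog ((h i : Matrix n n ℂ) * star (W : Matrix n n ℂ)))
          * (W : Matrix n n ℂ)) →
      ((HaarData.haar : Measure (Matrix.specialUnitaryGroup n ℂ)).restrict S).map K ≪ HaarData.haar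

/-- **THE CONTRACT IS MET AT `N = 2`**: `EMLFibreLaw (Fin 2)` is the tree's quaternionic fibre lemma
`T4EMLFibreAC.haarData_restrict_map_absolutelyContinuous_expMeanLog`. [folklore] -/
theorem emlFibreLaw_fin_two : EMLFibreLaw (Fin 2) := by
  intro ι _ S hS h c hc hs K hK hg hKW
  exact T4EMLFibreAC.haarData_restrict_map_absolutelyContinuous_expMeanLog hS h hc hs hK hg hKW

/-! ## 2. One-level averaging (0.4) on `SU(n)`: `HaarAC` and inhabitation from the fibre law -/

section OneLevel

variable {P : Params} {j : ℕ} {n : Type} [DecidableEq n] [Fintype n] [Nonempty n]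

/-- The guarded fibre laws of (0.4) with the printed average on `SU(n)` are absolutely continuous, GIVEN the fibre law:
the law applied at the open guard (`isOpen_fibreGuard`), the off-central open holonomies `h_k` (`offHol`), the uniform weights
`|I|⁻¹` of total `< 1` (`sum_emlWeight_lt_one`), and the normal form `coe_fibreCore_eq`. [folklore] -/
theorem haar_restrict_fibreGuard_map_absolutelyContinuous_of_fibreLaw (hFib : EMLFibreLaw n)
    (U : GaugeField P j (Matrix.specialUnitaryGroup n ℂ)) (c : PBond P (j+1)) :
    ((HaarData.haar : Measure (Matrix.specialUnitaryGroup n ℂ)).restrict (fibreGuard expMeanLogSU U c)).map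
        (fun W => expMeanLogSU.avg (fibreFamily U c W) * W) ≪ HaarData.haar :=
  hFib (isOpen_fibreGuard U c) (offHol U c) (fun _ => emlWeight P) (fun _ => emlWeight_nonneg P)
    (sum_emlWeight_lt_one c) (measurable_fibreCore expMeanLogSU measurable_expMeanLogSU_E U c)
    (fun W hW k => (norm_offHol_mul_star_sub_one_lt U c hW k).trans (by norm_num))
    (fun W hW => coe_fibreCore_eq U c hW)

/-- **`HaarAC` FOR (0.4) WITH THE PRINTED AVERAGE ON `SU(n)` FROM THE FIBRE LAW**, on every torus in the standing range
`j + 1 ≤ m + K` (`@`-explicit form fixing the torus and the group). [folklore] -/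
theorem haarAC_avgFun_expMeanLogSU_of_fibreLaw (hFib : EMLFibreLaw n) (hj : j + 1 ≤ P.m + P.K) :
    @T4FiniteEpsInhabited.HaarAC P j (Matrix.specialUnitaryGroup n ℂ) _ _ _ (avgFun expMeanLogSU) :=
  haarAC_avgFun_of_guard hj expMeanLogSU measurable_expMeanLogSU_E fun U c =>
    haar_restrict_fibreGuard_map_absolutelyContinuous_of_fibreLaw hFib U c

/-- `HaarAC` on every torus of a family in the standing range `k < K`, from the fibre law — the `k`-th instance of
`T4ApexTwoLevel.BlockHaarAC F expMeanLogSU` at `G = SU(n)`. [folklore] -/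
theorem haarAC_avgFun_expMeanLogSU_family_of_fibreLaw (hFib : EMLFibreLaw n) (F : T4Family) (K k : ℕ) (hk : k < K) :
    @T4FiniteEpsInhabited.HaarAC (F.P K) k (Matrix.specialUnitaryGroup n ℂ) _ _ _ (avgFun expMeanLogSU) :=
  haarAC_avgFun_expMeanLogSU_of_fibreLaw hFib (by show k + 1 ≤ F.m + K; omega)

/-- Block-averaged finite-`ε` data on `SU(n)` with the printed average EXIST, given the fibre law.  The inhabitant is the STUB
of `T4FiniteEpsInhabited` §3: carrier inhabitation, not the theorem. [folklore] -/
theorem exists_isBlockAveraged_expMeanLogSU_of_fibreLaw (hFib : EMLFibreLaw n) (F : T4Family) :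
    ∃ D : T4Continuum.FiniteEpsData F (Matrix.specialUnitaryGroup n ℂ), D.IsBlockAveraged expMeanLogSU :=
  T4FiniteEpsInhabited.exists_isBlockAveraged_of_haarAC F (Matrix.specialUnitaryGroup n ℂ) expMeanLogSU
    measurable_expMeanLogSU_E (fun K k hk => haarAC_avgFun_expMeanLogSU_family_of_fibreLaw hFib F K k hk)

/-- HONEST SCOPE: at the stub inhabitant the pinned end statement (B) FAILS (`T4FiniteEpsInhabited`). [folklore] -/
theorem not_endStatementBPrinted_blockAvgEML_stub_of_fibreLaw (hFib : EMLFibreLaw n) (F : T4Family) :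
    ¬ B16.EndStatementBPrinted
      (T4FiniteEpsInhabited.stubData F (Matrix.specialUnitaryGroup n ℂ) (fun _ _ => blockAvg expMeanLogSU)
        (fun _ _ => measurable_avgFun expMeanLogSU measurable_expMeanLogSU_E)
        (fun K k hk => haarAC_avgFun_expMeanLogSU_family_of_fibreLaw hFib F K k hk)).C :=
  T4FiniteEpsInhabited.not_endStatementBPrinted_of_stubData F _ _ _ _

end OneLevel

section OneLevelFin

variable {N : ℕ} [NeZero N]

/-- Hence, given the fibre law, finite-`ε` data on `SU(N)` averaging by (0.4) with the printed average exist and satisfy the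
reflection-positivity and torus-covariance targets in both forms (`FiniteEpsData.limit_rp_and_cov_of_blockAvgEML`, which
carries the citations). [folklore] -/
theorem exists_blockAvgEML_rp_and_cov_of_fibreLaw (hFib : EMLFibreLaw (Fin N)) (F : T4Family) :
    ∃ D : T4Continuum.FiniteEpsData F (Matrix.specialUnitaryGroup (Fin N) ℂ), D.IsBlockAveraged expMeanLogSU ∧
      (D.limit_reflectionPositive' ∧ D.limit_reflectionPositive) ∧ (D.limit_torusCovariant' ∧ D.limit_torusCovariant) := by
  obtain ⟨D, hD⟩ := exists_isBlockAveraged_expMeanLogSU_of_fibreLaw hFib F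
  exact ⟨D, hD, D.limit_rp_and_cov_of_blockAvgEML hD⟩

end OneLevelFin

/-! ## 3. Two-level averaging (0.11)–(0.12) on `SU(n)`, every inner `M`: `HaarAC` and inhabitation from the fibre law -/

section TwoLevel

variable {P : Params} {j : ℕ} {n : Type} [DecidableEq n] [Fintype n] [Nonempty n]
  (𝓜 : GroupAverage (Matrix.specialUnitaryGroup n ℂ))

/-- The guarded fibre laws of (0.12) with the printed OUTER average on `SU(n)` are absolutely continuous for every inner `M`,
GIVEN the fibre law: the law at the open guard (`isOpen_fibreGuard₂`), the non-central open parts `V_x` (`offHol₂`), the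
uniform weights `|B|⁻¹` of total `< 1` (`sum_emlWeight₂_lt_one`), and the normal form `coe_fibreCore₂_eq`. [folklore] -/
theorem haar_restrict_fibreGuard₂_map_absolutelyContinuous_of_fibreLaw (hFib : EMLFibreLaw n)
    (U : GaugeField P j (Matrix.specialUnitaryGroup n ℂ)) (c : PBond P (j+1)) :
    ((HaarData.haar : Measure (Matrix.specialUnitaryGroup n ℂ)).restrict (fibreGuard₂ 𝓜 expMeanLogSU U c)).map
        (fun W => expMeanLogSU.avg (fibreFamily₂ 𝓜 U c W) * W) ≪ HaarData.haar :=
  hFib (isOpen_fibreGuard₂ 𝓜 U c) (offHol₂ 𝓜 U c) (fun _ => emlWeight₂ P) (fun _ => emlWeight₂_nonneg P)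
    (sum_emlWeight₂_lt_one c) (measurable_fibreCore₂ 𝓜 expMeanLogSU measurable_expMeanLogSU_E U c)
    (fun W hW x => (norm_offHol₂_mul_star_sub_one_lt 𝓜 U c hW x).trans (by norm_num))
    (fun W hW => coe_fibreCore₂_eq 𝓜 U c hW)

/-- **`HaarAC` FOR (0.12) WITH THE PRINTED OUTER AVERAGE ON `SU(n)` FROM THE FIBRE LAW**, for every inner `M` with measurable
`M`, on every torus in the standing range `j + 1 ≤ m + K` (`@`-explicit form). [folklore] -/
theorem haarAC_avgFun₂_expMeanLogSU_of_fibreLaw (hFib : EMLFibreLaw n) (hj : j + 1 ≤ P.m + P.K)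
    (hM : ∀ m, Measurable (fun W : Fin (m+1) → Matrix.specialUnitaryGroup n ℂ => 𝓜.M W)) :
    @T4FiniteEpsInhabited.HaarAC P j (Matrix.specialUnitaryGroup n ℂ) _ _ _ (avgFun₂ 𝓜 expMeanLogSU) :=
  haarAC_avgFun₂_of_guard 𝓜 expMeanLogSU hj hM measurable_expMeanLogSU_E fun U c =>
    haar_restrict_fibreGuard₂_map_absolutelyContinuous_of_fibreLaw 𝓜 hFib U c

/-- `HaarAC` on every torus of a family in the standing range `k < K`, every inner `M` with measurable `M`, from the fibre law —
the `k`-th instance of `T4ApexTwoLevel.BlockHaarAC₂ F M expMeanLogSU` at `G = SU(n)`. [folklore] -/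
theorem haarAC_avgFun₂_expMeanLogSU_family_of_fibreLaw (hFib : EMLFibreLaw n)
    (hM : ∀ m, Measurable (fun W : Fin (m+1) → Matrix.specialUnitaryGroup n ℂ => 𝓜.M W)) (F : T4Family) (K k : ℕ)
    (hk : k < K) :
    @T4FiniteEpsInhabited.HaarAC (F.P K) k (Matrix.specialUnitaryGroup n ℂ) _ _ _ (avgFun₂ 𝓜 expMeanLogSU) :=
  haarAC_avgFun₂_expMeanLogSU_of_fibreLaw 𝓜 hFib (by show k + 1 ≤ F.m + K; omega) hM

/-- Finite-`ε` data on `SU(n)` averaging by (0.12) with the printed outer average EXIST for every inner `M` with measurable `M`,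
given the fibre law (stub inhabitant of `T4FiniteEpsInhabited` §3: carrier inhabitation, not the theorem). [folklore] -/
theorem exists_blockAvg₂_expMeanLogSU_of_fibreLaw (hFib : EMLFibreLaw n)
    (hM : ∀ m, Measurable (fun W : Fin (m+1) → Matrix.specialUnitaryGroup n ℂ => 𝓜.M W)) (F : T4Family) :
    ∃ D : T4Continuum.FiniteEpsData F (Matrix.specialUnitaryGroup n ℂ), ∀ K j, D.av K j = blockAvg₂ 𝓜 expMeanLogSU :=
  ⟨T4FiniteEpsInhabited.stubData F _ (fun _ _ => blockAvg₂ 𝓜 expMeanLogSU)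
      (fun _ _ => measurable_avgFun₂ 𝓜 expMeanLogSU hM measurable_expMeanLogSU_E)
      (fun K k hk => haarAC_avgFun₂_expMeanLogSU_family_of_fibreLaw 𝓜 hFib hM F K k hk),
    fun _ _ => rfl⟩

/-- HONEST SCOPE: at that stub inhabitant the pinned end statement (B) FAILS. [folklore] -/
theorem not_endStatementBPrinted_blockAvg₂EML_stub_of_fibreLaw (hFib : EMLFibreLaw n)
    (hM : ∀ m, Measurable (fun W : Fin (m+1) → Matrix.specialUnitaryGroup n ℂ => 𝓜.M W)) (F : T4Family) :
    ¬ B16.EndStatementBPrinted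
      (T4FiniteEpsInhabited.stubData F (Matrix.specialUnitaryGroup n ℂ) (fun _ _ => blockAvg₂ 𝓜 expMeanLogSU)
        (fun _ _ => measurable_avgFun₂ 𝓜 expMeanLogSU hM measurable_expMeanLogSU_E)
        (fun K k hk => haarAC_avgFun₂_expMeanLogSU_family_of_fibreLaw 𝓜 hFib hM F K k hk)).C :=
  T4FiniteEpsInhabited.not_endStatementBPrinted_of_stubData F _ _ _ _

end TwoLevel

section TwoLevelFin

variable {N : ℕ} [NeZero N] (𝓜 : GroupAverage (Matrix.specialUnitaryGroup (Fin N) ℂ))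

/-- Hence, given the fibre law, finite-`ε` data on `SU(N)` averaging by (0.12) (any measurable inner `M`, printed outer average)
exist and satisfy the reflection-positivity and torus-covariance targets in both forms (discharge theorems of
`BlockAveragingTwoLevel` §6, which carry the citations). [folklore] -/
theorem exists_blockAvg₂_expMeanLogSU_rp_and_cov_of_fibreLaw (hFib : EMLFibreLaw (Fin N))
    (hM : ∀ m, Measurable (fun W : Fin (m+1) → Matrix.specialUnitaryGroup (Fin N) ℂ => 𝓜.M W)) (F : T4Family) :
    ∃ D : T4Continuum.FiniteEpsData F (Matrix.specialUnitaryGroup (Fin N) ℂ), (∀ K j, D.av K j = blockAvg₂ 𝓜 expMeanLogSU) ∧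
      (D.limit_reflectionPositive' ∧ D.limit_reflectionPositive) ∧ (D.limit_torusCovariant' ∧ D.limit_torusCovariant) := by
  obtain ⟨D, hD⟩ := exists_blockAvg₂_expMeanLogSU_of_fibreLaw 𝓜 hFib hM F
  exact ⟨D, hD, D.avg_limit_reflectionPositive_SU
    (D.avgMeasurable_of_blockAvg₂ 𝓜 expMeanLogSU hM measurable_expMeanLogSU_E hD), D.limit_torusCovariant_of_blockAvg₂ _ _ hD⟩

end TwoLevelFin

/-! ## 4. Consistency: the landed `SU(2)` theorems are the instances at `emlFibreLaw_fin_two` (examples, no new declarations) -/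

section SU2

variable {P : Params} {j : ℕ} (𝓜 : GroupAverage (Matrix.specialUnitaryGroup (Fin 2) ℂ))

example (hj : j + 1 ≤ P.m + P.K) :
    @T4FiniteEpsInhabited.HaarAC P j (Matrix.specialUnitaryGroup (Fin 2) ℂ) _ _ _ (avgFun expMeanLogSU) :=
  haarAC_avgFun_expMeanLogSU_of_fibreLaw emlFibreLaw_fin_two hj

example (F : T4Family) (K k : ℕ) (hk : k < K) :
    @T4FiniteEpsInhabited.HaarAC (F.P K) k (Matrix.specialUnitaryGroup (Fin 2) ℂ) _ _ _ (avgFun expMeanLogSU) :=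
  haarAC_avgFun_expMeanLogSU_family_of_fibreLaw emlFibreLaw_fin_two F K k hk

example (hj : j + 1 ≤ P.m + P.K) (hM : ∀ m, Measurable (fun W : Fin (m+1) → Matrix.specialUnitaryGroup (Fin 2) ℂ => 𝓜.M W)) :
    @T4FiniteEpsInhabited.HaarAC P j (Matrix.specialUnitaryGroup (Fin 2) ℂ) _ _ _ (avgFun₂ 𝓜 expMeanLogSU) :=
  haarAC_avgFun₂_expMeanLogSU_of_fibreLaw 𝓜 emlFibreLaw_fin_two hj hM

/-- The landed `SU(2)` theorem and the instance of the general one have the same statement. -/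
example (F : T4Family) (K k : ℕ) (hk : k < K) :
    haarAC_avgFun_expMeanLogSU_family_of_fibreLaw emlFibreLaw_fin_two F K k hk =
      BlockAveragingEMLHaarAC.haarAC_avgFun_expMeanLogSU F K k hk := rfl

end SU2

end BlockAveragingEMLHaarACSUN

end Literature.MathematicalPhysics.QuantumFieldTheory.Balaban1983to89

end
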